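import Summits.Ventures.CertifiedManyBodySolver.Certificates.S2Rm2uTierP.Head
import Summits.Ventures.CertifiedManyBodySolver.Certificates.S2Rm2uTierP.Hints022
import Summits.Ventures.CertifiedManyBodySolver.Rows.CorrWindowCertKernelChainQuotAdjFastBox

/-!
# tier-P instance (S2Rm2u-R13-W3) — chain forest segment 96 of 103 (steps 327..329 from `[]`), file 1 of 1: steps 327..329 (topology (B): eval%-chained accumulators, import-serial INSIDE the segment only)

Generated by hubbard-algo-p2's untrusted exporter (emit_v0.py + emit_w3.py); every datum below is re-derived / re-checked by the kernel chain
(`stepEQA`, Rows/CorrWindowCertKernelChainQuotAdj.lean) or is inert. HONEST FRAMING (xx1): instance data / kernel replay of a CONTROL/CALIBRATION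
certificate (S2′-Rm2-u″ OVERHANG pinned spoke of the La214-E t′-pair {S2′ −357/740, hub′ −3/10}: t′ = −357/740, CORNER objective t′_X = −3/10, eom multipliers PINNED to the hub-Rm2-u′ certificate (EB by name), sdp-1 (R1) C-edition j326976, 4^40-dyadic two-level Gram factors); nothing here is a theorem about the Hubbard model; no summit statement. [cite: Han2020Bootstrap, §3]
-/

set_option linter.style.longLine false
set_option maxRecDepth 100000
set_option maxHeartbeats 0

namespace Summit.Ventures.CertifiedManyBodySolver
namespace CARPolyWindow.TierP.S2Rm2u
open Summit.Ventures.CertifiedQuantumChemistry Summit.Ventures.CertifiedQuantumChemistry.CARPoly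
open Literature.MathematicalPhysics.QuantumLattice Literature.MathematicalPhysics.QuantumLattice.HubbardWave0
open Literature.Probability.LatticeModels
open CARPolyWindow CARPolyWindow.BoxGeom

/-- segment 96 starts from the EMPTY accumulator before step 327 (chain forest, R-g4-11 (L6)). [folklore] -/
def C96_0 : SOSDual.EncPoly := []

/-- accumulator after step 328 within segment 96 (evaluated at elaboration; the kernel re-derives it in `step_327`). [folklore] -/
def C96_1 : SOSDual.EncPoly := eval% stepEQA D 2048 C96_0 (slices.getD 327 []) (hintsOfCodes Dr reps HC327)

/-- KERNEL FACT, step 327 of 350 (fast step (L7): `stepEQAFB_kernel`, box edition). [folklore] -/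
theorem step_327 : C96_1 = stepEQA D 2048 C96_0 (slices.getD 327 []) (hintsOfCodes Dr reps HC327) :=
  stepEQAFB_kernel 6 13 7 rfl (by decide +kernel)

/-- accumulator after step 329 within segment 96 (evaluated at elaboration; the kernel re-derives it in `step_328`). [folklore] -/
def C96_2 : SOSDual.EncPoly := eval% stepEQA D 2048 C96_1 (slices.getD 328 []) (hintsOfCodes Dr reps HC328)

/-- KERNEL FACT, step 328 of 350 (fast step (L7): `stepEQAFB_kernel`, box edition). [folklore] -/
theorem step_328 : C96_2 = stepEQA D 2048 C96_1 (slices.getD 328 []) (hintsOfCodes Dr reps HC328) :=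
  stepEQAFB_kernel 6 13 7 rfl (by decide +kernel)

/-- accumulator after step 330 within segment 96 (evaluated at elaboration; the kernel re-derives it in `step_329`). [folklore] -/
def C96_3 : SOSDual.EncPoly := eval% stepEQA D 2048 C96_2 (slices.getD 329 []) (hintsOfCodes Dr reps HC329)

/-- KERNEL FACT, step 329 of 350 (fast step (L7): `stepEQAFB_kernel`, box edition). [folklore] -/
theorem step_329 : C96_3 = stepEQA D 2048 C96_2 (slices.getD 329 []) (hintsOfCodes Dr reps HC329) :=
  stepEQAFB_kernel 6 13 7 rfl (by decide +kernel)


end CARPolyWindow.TierP.S2Rm2u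
end Summit.Ventures.CertifiedManyBodySolver
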